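import Mathlib
import HarnessLib
import HarnessLib.Audit
import Summits.PneNP.PneNP.Theses.FreeHardnessEF
import Literature.Computability.Complexity.ProofComplexityProofs
import Literature.Computability.MetaComplexity.TextbookFregeCompleteness
import Literature.Computability.MetaComplexity.TruthTables
import Literature.Computability.MetaComplexity.EFSoundness

/-!
# Line `birth` — BC3 skeleton for the crux `HardnessTransfer` (stmt-PneNP-18211)

Route `FreeHardnessEF` (route-PneNP-FreeHardnessEF), crux (rank 2)
`HardnessTransfer : (∀ c, ∃ L ∈ P, ∀ᶠ n, n ^ c < L.circuitSize n) → ∀ F, IsFrege F → ¬ F.IsEFPolyBounded`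
— "if `P` has no fixed-polynomial circuit-size bound almost everywhere, then no extended Frege system is
polynomially bounded": the Razborov–Krajíček TRANSFER of circuit hardness of explicit functions to
proof hardness (Razborov, ICALP'96, LNCS 1099, §5 pp. 61–63; Krajíček, *Proof complexity* (CUP 2019) §19.5).

THE LINE = THE DIRECT TRANSFER THROUGH THE TRUTH-TABLE TAUTOLOGIES OF THE HARD LANGUAGE, with the crux's
hypothesis LOAD-BEARING (it is what makes the formulas tautologies and what pins them to ONE explicit family),
cut into its two genuine ingredients over Razborov's CNF `Circuit_{s,n}(f, q)` ("`q` can simply encode all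
instructions of the circuit as well as truth-tables of all intermediate results", ICALP'96 p. 62), which the tree
lacks (GeneratorHardnessCriterion.lean: "the tree has no τ-formulas yet"; route header, DEFINITION REQUEST D1)
and which is therefore DEFINED here, transparently, as `TT.circuitCNF` / `TT.ttForm s n f := ¬ Circuit_{s,n}(f, q)`:

* `stub_ttTautOfHard` — COMPLETENESS OF THE ENCODING (provable now, size M): if no `B₂`-circuit with `≤ s`
  gates computes `f : {0,1}ⁿ → {0,1}` (`s < circuitSizeOver B2 f`) then `tt(s, n, f)` is a tautology — every
  assignment satisfying `Circuit_{s,n}(f, q)` DECODES (least selected wire per argument; op-table bits as the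
  binary gate; output wire) to a well-formed straight-line program over `B₂` with `s` gates whose row-by-row
  values are forced by the wiring/gate/output clauses (induction on the gate index) and whose result column is
  `f` by the target clauses; `circuitSizeOver_le_of_computes` finishes. (The converse, soundness for `0 < n`,
  is true — normalise a small circuit to `s` binary gates and read off the assignment — but is not used.)
* `stub_ttHardForEF` — THE OPEN CORE, Razborov's conjecture in Krajíček's fixed-polynomial regime, WEAKENED TO
  EXPLICIT FUNCTIONS (the only instances the crux needs): there is an exponent `c` such that for every
  polynomial-time language `L` whose slices have circuit complexity `> n ^ c` at all large `n`, and every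
  polynomial `p`, at infinitely many `n` NO extended-Frege proof over `textbookFrege` of `tt(n^c, n, L ∩ {0,1}ⁿ)`
  has size `≤ p(|tt(n^c, n, L ∩ {0,1}ⁿ)|)` (the formula has size `2ⁿ · poly(n^c)`, so this is "no proofs of size
  polynomial in `2ⁿ`"). Implied by: Krajíček's Thm 19.5.3 (ii) hypothesis "some `P/poly` map stretching by one
  bit is exponentially iterable for EF" (then `tt_{k^c,k}` is exponentially iterable, hence hard, for ALL tables
  outside its range, explicit or not); by Razborov's Conjecture for EF. NOT implied by, and not implying, an
  unconditional EF lower bound: it speaks about these formulas only, and for a language with easy slices it is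
  silent (guard `∀ᶠ n, n ^ c < L.circuitSize n`). Why it might fail: EF may prove TRUE fixed-polynomial lower
  bounds for explicit functions in size `poly(2ⁿ)` (Razborov's thesis, ICALP'96 p. 62: all known restricted lower
  bounds ARE such EF-proofs; Müller–Pich 2020 formalise them in `APC₁`); Krajíček L19.5.1 (i): `tt_{s,k}` is not
  hard for SOME proof system once `NE ∩ coNE ⊄ Size(s)` — which is why the stub names ONE system, EF.
* the composition `HardnessTransfer_of : Sig₁ → Sig₂ → <crux body verbatim>` — sorry-free: Cook–Reckhow's
  Cor. 4.7 PROVED in the tree (`FregeSystem.IsEFPolyBounded.of_isImplicationallyComplete` with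
  `isFrege_textbookFrege_holds`) moves p-boundedness of EF over the given Frege `F` to EF over `textbookFrege`
  with polynomial `p`; stub 2 gives `c`; the crux hypothesis gives `L ∈ P` hard a.e. for `n ^ c`; a.e.-hardness
  ∧ i.o.-proof-hardness meet at some `n` (`Filter.Eventually.and_frequently`); there stub 1 makes `tt` a
  tautology, so it has an EF proof of size `≤ p(|tt|)`, which stub 2 forbids. THE SKELETON THEOREM
  `HardnessTransfer_proof : HardnessTransfer` concludes the crux BY NAME from the two declared stubs (the file's
  only `sorry`s) — the only theorem here whose head is the crux name (what `ledger skeleton check` keys on);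
  `example : Sig₁ → Sig₂ → HardnessTransfer := HardnessTransfer_of` records the instruction's literal shape.

Size of the encoding (for reading stub 2): variables `O(2ⁿ·s + s·(n+s))`; clauses `2s + 1` selector clauses of
width `≤ n + s`, `2ⁿ·n` input units, `4·2ⁿ·s·(n+s)` wiring clauses (width 3), `8·2ⁿ·s` gate clauses (width 4),
`2·2ⁿ·(n+s)` output clauses (width 3), `2ⁿ` target units; `|ttForm s n f| = Θ(2ⁿ · s · (n + s))` symbols.

Disproof used (`Cruxes/HardnessTransfer/Disproof.lean`, refuter birth attack 2026-08-17, NO KILL, `-- Targets: none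
yet`): `hardnessTransferWithoutIsFrege_iff` / `transferCompleteOnly_iff` — SOUNDNESS of `F` is load-bearing: honoured,
stub 2 is stated for the sound system `textbookFrege` and the composition consumes `hF.1` (at the Cook–Reckhow transfer);
`efNotPolyBounded_iff_forall_isSound` — completeness is not load-bearing: consistent, `hF.2` is never used;
`transfer_iff_of_SigmaP_four_subset` / `hardnessTransfer_iff_efNotPolyBounded_of_not_pneNP` — the UNIFORMITY `L ∈ P`
is the crux's only discount on S32 and "any proof must consume `L ∈ P`": honoured at `stub_ttHardForEF`, which is
stated for `L ∈ Classes.P` only (a proof of it through an exponentially iterable map alone would prove S32 outright —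
recorded in the card as the line's known leak, not hidden); `not_freeHardness_swapped` — quantifier order: stub 2 keeps
`∃ c` outside `∀ L`, compatible with the meaningful order `∀ c ∃ L` of the hypothesis. No Negative lemma has landed;
negatives index (`ledger negatives --problem PneNP`): none on Frege/EF/circuit-lower-bound tautologies; no stub is an
instance of a refuted statement. Barriers: NaturalProofs does not bite (stub 2 asserts UNprovability of lower bounds, the
Razborov–Rudich direction); Relativization/Algebrization: EF-provability of a white-box statement about an explicit
`L` is not an oracle-invariant statement (the escaping hypothesis; cheapest falsifier of the route: a relativized
world with `P` a.e.-hard and EF p-bounded in Krajíček's `T(α)` sense would show stub 2 needs a non-relativizing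
proof); FeasibleInterpolationEF: stub 2 cannot be reached by interpolation (Krajíček–Pudlák 1998), the bet is
iterability / a generator exponentially iterable for EF (Krajíček 2004, Thm 19.5.3 (ii)).
Planner planner-skel-stmt-PneNP-18211-0, 2026-08-17.
-/

set_option linter.dupNamespace false
set_option linter.unusedVariables false

namespace Summit.PneNP.PneNP.Cruxes.HardnessTransfer.Birth

open Literature.Computability.Complexity
open Literature.Computability.MetaComplexity
open Summit.PneNP.PneNP.Theses.FreeHardnessEF

/-! ## Vocabulary of the line: Razborov's CNF `Circuit_{s,n}(f, q)` and the truth-table tautology `tt(s, n, f)`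

Transparent definitions, no content. Sources `w < n + s` of a straight-line program with `n` inputs and `s`
binary gates: `w < n` is the input `w`, `w = n + j` is gate `j < s`. Rows `x < 2ⁿ` are the inputs, numbered by
`boolFunEquivFin n` (`TruthTables.lean`). Propositional variables (all in `ℕ`, kept apart by `Nat.pair` tags):
the DESCRIPTION `q` — op-table bits `opV j a b`, argument selectors `selV j k w` (`k < 2`, `w < n + j`), output
selector `outV w` (`w < n + s`) — and the INTERMEDIATE TRUTH TABLES — input bits `inV x i`, gate values
`gateV x j`, argument values `argV x j k`, result `resV x`. -/

namespace TT

/-- Variable layout: a tag and three indices, packed injectively into `ℕ` by `Nat.pair`. [folklore] -/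
def v (tag a b c : ℕ) : ℕ := Nat.pair tag (Nat.pair a (Nat.pair b c))

/-- `opV j a b` — the op-table bit of gate `j` at argument values `(a, b)` (description variable).
[cite: Razborov1996ICALP, §5 p. 62 (`q` encodes the instructions)] -/
def opV (j : ℕ) (a b : Bool) : ℕ := v 0 j (cond a 1 0) (cond b 1 0)

/-- `selV j k w` — argument `k < 2` of gate `j` is wired to source `w < n + j` (description variable).
[cite: Razborov1996ICALP, §5 p. 62] -/
def selV (j k w : ℕ) : ℕ := v 1 j k w

/-- `outV w` — the output wire is source `w < n + s` (description variable). [cite: Razborov1996ICALP, §5 p. 62] -/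
def outV (w : ℕ) : ℕ := v 2 w 0 0

/-- `inV x i` — the value of input `i` on row `x` (fixed to the `i`-th bit of row `x` by a unit clause).
[cite: Razborov1996ICALP, §5 p. 62 (truth tables of intermediate results)] -/
def inV (x i : ℕ) : ℕ := v 3 x i 0

/-- `gateV x j` — the value of gate `j` on row `x`. [cite: Razborov1996ICALP, §5 p. 62] -/
def gateV (x j : ℕ) : ℕ := v 4 x j 0

/-- `argV x j k` — the value of argument `k` of gate `j` on row `x`. [cite: Razborov1996ICALP, §5 p. 62] -/
def argV (x j k : ℕ) : ℕ := v 5 x j k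

/-- `resV x` — the value of the output wire on row `x`. [cite: Razborov1996ICALP, §5 p. 62] -/
def resV (x : ℕ) : ℕ := v 6 x 0 0

/-- The value variable of source `w` on row `x`: input `w` if `w < n`, else gate `w - n`. [folklore] -/
def srcV (n x w : ℕ) : ℕ := if w < n then inV x w else gateV x (w - n)

/-- Selector clauses: every argument of every gate, and the output, select AT LEAST ONE admissible source
(argument `k` of gate `j` among the `n + j` earlier sources — acyclicity is built in; the output among all
`n + s`). For `n = 0` the clause of gate `0` is empty, so the CNF is unsatisfiable — harmless for the direction
used by the line. [cite: Razborov1996ICALP, §5 p. 62] -/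
def selClauses (s n : ℕ) : CNF ℕ :=
  ((List.range s).flatMap fun j => (List.range 2).map fun k =>
      (List.range (n + j)).map fun w => (selV j k w, true)) ++
    [(List.range (n + s)).map fun w => (outV w, true)]

/-- Input clauses: on row `x` the input variable `inV x i` carries the `i`-th bit of the `x`-th assignment
`(boolFunEquivFin n).symm x`. [cite: Razborov1996ICALP, §5 p. 62] -/
def inputClauses (n : ℕ) : CNF ℕ :=
  (List.finRange (2 ^ n)).flatMap fun x =>
    (List.finRange n).map fun i => [(inV x.1 i.1, (boolFunEquivFin n).symm x i)]

/-- Wiring clauses: if argument `k` of gate `j` selects source `w` then on every row its value equals the value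
of `w`: `selV j k w → (argV x j k ↔ srcV x w)`, two 3-clauses. [cite: Razborov1996ICALP, §5 p. 62] -/
def argClauses (s n : ℕ) : CNF ℕ :=
  (List.range (2 ^ n)).flatMap fun x => (List.range s).flatMap fun j =>
    (List.range 2).flatMap fun k => (List.range (n + j)).flatMap fun w =>
      [[(selV j k w, false), (argV x j k, false), (srcV n x w, true)],
        [(selV j k w, false), (argV x j k, true), (srcV n x w, false)]]

/-- Gate clauses: on every row the value of gate `j` is its op-table bit at its argument values:
`argV x j 0 = a ∧ argV x j 1 = b → (gateV x j ↔ opV j a b)`, two 4-clauses per `(a, b)`.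
[cite: Razborov1996ICALP, §5 p. 62] -/
def gateClauses (s n : ℕ) : CNF ℕ :=
  (List.range (2 ^ n)).flatMap fun x => (List.range s).flatMap fun j =>
    [false, true].flatMap fun a => [false, true].flatMap fun b =>
      [[(argV x j 0, !a), (argV x j 1, !b), (gateV x j, false), (opV j a b, true)],
        [(argV x j 0, !a), (argV x j 1, !b), (gateV x j, true), (opV j a b, false)]]

/-- Output clauses: if the output selects source `w` then on every row the result equals the value of `w`:
`outV w → (resV x ↔ srcV x w)`. [cite: Razborov1996ICALP, §5 p. 62] -/
def outClauses (s n : ℕ) : CNF ℕ :=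
  (List.range (2 ^ n)).flatMap fun x => (List.range (n + s)).flatMap fun w =>
    [[(outV w, false), (resV x, false), (srcV n x w, true)],
      [(outV w, false), (resV x, true), (srcV n x w, false)]]

/-- Target clauses: on every row the result is the value of `f` — the truth table of `f` is hard-wired, as in
Razborov's `Circuit_{t,n}(f_n, q)` / Pich–Santhanam's `tt(f, s)`. [cite: Razborov1996ICALP, §5 p. 62]
[cite: PichSanthanam2021learaut, §3.1 (propositional version)] -/
def targetClauses (n : ℕ) (f : (Fin n → Bool) → Bool) : CNF ℕ :=
  (List.finRange (2 ^ n)).map fun x => [(resV x.1, f ((boolFunEquivFin n).symm x))]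

/-- **Razborov's CNF `Circuit_{s,n}(f, q)`**: "`q` describes a `B₂`-circuit with `n` inputs and `s` (binary)
gates, the value columns are its intermediate truth tables, and it computes `f`". Size `Θ(2ⁿ · s · (n + s))`.
[cite: Razborov1996ICALP, §5 p. 62] [cite: KrajicekProofComplexity2019, §19.5 p. 425 (τ(tt_{s,k})_b)] -/
def circuitCNF (s n : ℕ) (f : (Fin n → Bool) → Bool) : CNF ℕ :=
  selClauses s n ++ inputClauses n ++ argClauses s n ++ gateClauses s n ++ outClauses s n ++
    targetClauses n f

/-- **The truth-table tautology `tt(s, n, f) := ¬ Circuit_{s,n}(f, q)`** — "no `B₂`-circuit with `s` gates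
computes `f`", i.e. the circuit lower bound `size_{B₂}(f) > s`, as a propositional formula over `PropForm ℕ`
(Razborov's `¬Circuit_{t,n}(f_n, q)`; Krajíček's `τ(tt_{s,k})_b` for the obvious evaluator circuit of the
truth-table function). [cite: Razborov1996ICALP, §5 p. 62] [cite: KrajicekProofComplexity2019, §19.5 p. 425] -/
def ttForm (s n : ℕ) (f : (Fin n → Bool) → Bool) : PropForm ℕ :=
  PropForm.neg (PropForm.ofCNF (circuitCNF s n f))

end TT

/-! ## The two registered stubs -/

/-- **Stub 1 — completeness of the encoding** (provable now, size M). If no `B₂`-circuit with at most `s`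
gates computes `f` (`s < circuitSizeOver B2 f`; over `B₂` the infimum is attained, `exists_computes_B2`), then
`tt(s, n, f)` is a tautology: a falsifying assignment satisfies `Circuit_{s,n}(f, q)` (`PropForm.eval_ofCNF`) and
DECODES — per argument the least selected source (`selClauses`), the op-table bits as a binary gate of `B₂`, the
least selected output — to a `Circuit (Fin n)` with `s` gates (`Circuit.wf` from `w < n + j`), whose values on
row `x` are forced to be `inV/argV/gateV/resV` by `inputClauses/argClauses/gateClauses/outClauses` (induction on
the gate index along `Circuit.wireVals`), and which therefore `Computes f` by `targetClauses`; then
`circuitSizeOver_le_of_computes` contradicts `s < circuitSizeOver B2 f`. Holds for `n = 0` trivially (empty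
selector clause). [cite: Razborov1996ICALP, §5 p. 62] [cite: AroraBarakCC2009, Def. 6.1 (straight-line programs)] -/
theorem stub_ttTautOfHard :
    ∀ (s n : ℕ) (f : (Fin n → Bool) → Bool),
      s < circuitSizeOver B2 f → (TT.ttForm s n f).IsTautology := by
  sorry

/-- **Stub 2 — truth-table tautologies of hard explicit languages are hard for EF** (OPEN: Razborov's
conjecture, ICALP'96 §5, in Krajíček's fixed-polynomial regime `s = k^c`, Thm 19.5.3 (ii), WEAKENED to the
explicit tables the crux supplies). There is an exponent `c` such that for every `L ∈ P` whose slices have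
`B₂`-circuit complexity `> n ^ c` at all large `n`, and every polynomial `p`, for infinitely many `n` every
extended-Frege proof over `textbookFrege` of `tt(n ^ c, n, L ∩ {0,1}ⁿ)` has size `> p(|tt(n ^ c, n, L ∩ {0,1}ⁿ)|)`
(`|tt| = 2ⁿ · poly(n)`: no proofs of size polynomial in `2ⁿ`). Sufficient: some `P/poly` map stretching by one
bit is exponentially iterable for EF (Krajíček 2004 / 2019 Thm 19.5.3 (ii): then `tt_{k^c,k}` is exponentially
iterable, hence hard, at every table outside its range). Why it might fail: EF may prove true `n ^ c` lower bounds
for explicit functions in size `poly(2ⁿ)` — all known restricted-class bounds are such proofs (Razborov's thesis;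
Müller–Pich 2020, `APC₁`), and by Krajíček L19.5.1 (i) `tt` is not hard for SOME proof system, so everything
rests on EF specifically; any proof is expected to be non-relativizing and cannot go through feasible
interpolation (Krajíček–Pudlák 1998). [cite: Razborov1996ICALP, §5 pp. 62–63]
[cite: KrajicekProofComplexity2019, §19.5 Thm 19.5.3 (ii), L19.5.1 (i), L19.5.4] [cite: Krajicek2004dwphp, Thm 5.2]
[cite: PichSanthanam2021learaut, §1 (plausibility of provable lower bounds)] -/
theorem stub_ttHardForEF :
    ∃ c : ℕ, ∀ L ∈ Literature.Computability.Complexity.Classes.P,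
      (∀ᶠ n in Filter.atTop, n ^ c < L.circuitSize n) →
        ∀ p : Polynomial ℕ, ∃ᶠ n in Filter.atTop, ∀ π : List (PropForm ℕ),
          textbookFrege.IsEFProofOf π (TT.ttForm (n ^ c) n (L.sliceFn n)) →
            p.eval (TT.ttForm (n ^ c) n (L.sliceFn n)).size < proofSize π := by
  sorry

/-! ## The composition (sorry-free) and the skeleton theorem -/

/-- **THE COMPOSITION** `Sig₁ → Sig₂ → crux`: hypotheses = the two stub signatures VERBATIM, conclusion = the
crux's body VERBATIM (so that `HardnessTransfer_proof` is the file's only theorem headed by the crux name).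
Assume the a.e. fixed-polynomial hardness of `P`, a Frege system `F` and, for contradiction, `F.IsEFPolyBounded`.
Cook–Reckhow Cor. 4.7 (PROVED in the tree: `FregeSystem.IsEFPolyBounded.of_isImplicationallyComplete`,
`isFrege_textbookFrege_holds`) makes EF over `textbookFrege` p-bounded by some `p`. Take `c` from stub 2 and
`L ∈ P` a.e.-hard for `n ^ c` from the hypothesis; a.e.-hardness and the i.o. proof-hardness of stub 2 hold
together at some `n` (`Filter.Eventually.and_frequently`). There `tt(n^c, n, L ∩ {0,1}ⁿ)` is a tautology by
stub 1 (`L.circuitSize n` is `circuitSizeOver B2 (L.sliceFn n)` by definition), so it has an EF proof over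
`textbookFrege` of size `≤ p(|tt|)` — contradicting stub 2. [cite: CookReckhow1979, Cor. 4.7]
[cite: KrajicekProofComplexity2019, §19.5] -/
theorem HardnessTransfer_of
    (h₁ : ∀ (s n : ℕ) (f : (Fin n → Bool) → Bool),
      s < circuitSizeOver B2 f → (TT.ttForm s n f).IsTautology)
    (h₂ : ∃ c : ℕ, ∀ L ∈ Literature.Computability.Complexity.Classes.P,
      (∀ᶠ n in Filter.atTop, n ^ c < L.circuitSize n) →
        ∀ p : Polynomial ℕ, ∃ᶠ n in Filter.atTop, ∀ π : List (PropForm ℕ),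
          textbookFrege.IsEFProofOf π (TT.ttForm (n ^ c) n (L.sliceFn n)) →
            p.eval (TT.ttForm (n ^ c) n (L.sliceFn n)).size < proofSize π) :
    (∀ c : ℕ, ∃ L ∈ Literature.Computability.Complexity.Classes.P,
        ∀ᶠ n in Filter.atTop, n ^ c < L.circuitSize n) →
      ∀ F : Literature.Computability.MetaComplexity.FregeSystem,
        Literature.Computability.MetaComplexity.IsFrege F → ¬ F.IsEFPolyBounded := by
  intro hH F hF hEF
  -- Cook–Reckhow Cor. 4.7, proved in the tree: EF over `textbookFrege` is p-bounded as well
  have hT : textbookFrege.IsEFPolyBounded :=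
    FregeSystem.IsEFPolyBounded.of_isImplicationallyComplete isFrege_textbookFrege_holds.2 hF.1 hEF
  obtain ⟨c, hc⟩ := h₂
  obtain ⟨L, hLP, hae⟩ := hH c
  obtain ⟨p, hp⟩ := hT
  obtain ⟨n, hhard, hlong⟩ := (hae.and_frequently (hc L hLP hae p)).exists
  have htaut : (TT.ttForm (n ^ c) n (L.sliceFn n)).IsTautology :=
    h₁ (n ^ c) n (L.sliceFn n) hhard
  obtain ⟨π, hπ, hsize⟩ := hp _ htaut
  exact absurd hsize (not_le.2 (hlong π hπ))

/-- **THE SKELETON THEOREM.** The crux `Summit.PneNP.PneNP.Theses.FreeHardnessEF.HardnessTransfer`, concluded BY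
NAME from the two DECLARED stubs `stub_ttTautOfHard`, `stub_ttHardForEF` (the file's only `sorry`s) through the
sorry-free composition `HardnessTransfer_of`. [cite: KrajicekProofComplexity2019, §19.5] -/
theorem HardnessTransfer_proof : HardnessTransfer :=
  HardnessTransfer_of stub_ttTautOfHard stub_ttHardForEF

/-- The instruction's literal shape `<stub sigs> → HardnessTransfer` (the crux unfolds to the composition's
conclusion definitionally). [cite: KrajicekProofComplexity2019, §19.5] -/
example :
    (∀ (s n : ℕ) (f : (Fin n → Bool) → Bool),
      s < circuitSizeOver B2 f → (TT.ttForm s n f).IsTautology) →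
    (∃ c : ℕ, ∀ L ∈ Literature.Computability.Complexity.Classes.P,
      (∀ᶠ n in Filter.atTop, n ^ c < L.circuitSize n) →
        ∀ p : Polynomial ℕ, ∃ᶠ n in Filter.atTop, ∀ π : List (PropForm ℕ),
          textbookFrege.IsEFProofOf π (TT.ttForm (n ^ c) n (L.sliceFn n)) →
            p.eval (TT.ttForm (n ^ c) n (L.sliceFn n)).size < proofSize π) →
    HardnessTransfer :=
  HardnessTransfer_of

end Summit.PneNP.PneNP.Cruxes.HardnessTransfer.Birth
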